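import Literature.AnabelianGeometry.SemiGraphs.TemperedCurveSlimOfTower
import Literature.AnabelianGeometry.SemiGraphs.TemperedOpenMapping
import HarnessLib

/-!
# [SemiAnbd] Example 3.10, conclusion "`Δ` and `Π` are temp-slim" — WITHOUT the `AugIsOpenMap` binder

Mochizuki, *Semi-graphs of anabelioids*, Publ. RIMS **42** (2006), Example 3.10 p. 45 l. 10–12
[cite: MochizukiSemiAnbd2006, Ex 3.10 p.45]: "Since `Δ` is the inverse limit of the `Δ[i]`, and `G_K`
is slim …, we thus conclude that both `Δ` and `Π` are temp-slim."

Proof-only companion of `TemperedSpecialFibreTower.lean` (abc-iut-w5-d122, sub-DAG SemiAnbd:Ex3.10)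
and `TemperedCurveSlimOfTower.lean`: those files derive the slimness of `Π` from a special-fibre tower
PLUS the additive named hypothesis `TemperedArithmeticGroup.AugIsOpenMap` (resp. `IsOpenMap X.aug`).
By the open mapping theorem for tempered groups (`TemperedOpenMapping.lean`:
`TemperedArithmeticGroup.augIsOpenMap_holds`, `TemperedCurve.isOpenMap_aug_of_isTempered`) that
binder is a THEOREM, so the conclusion of Example 3.10 holds from the tower data alone (group-level
interface), resp. from the tower data + "`Π^temp_{X_K}` tempered and Galois-countable" (§6 curve-level
interface, which does not record temperedness).  Nothing in the parent files is edited.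

Refereed pre-IUT material; nothing here bears on [IUTchIII] Cor. 3.12; typed ≠ discharged.
-/

noncomputable section

namespace Literature.AnabelianGeometry.SemiGraphs

open Literature.AlgebraicGeometry.Frobenioids (IsSlimGroup)
open Literature.AnabelianGeometry.AbsoluteAnabelian (galoisMLF_slim_holds)

universe u

section GroupLevel

variable {K : Type u} [Field K]

/-- **Example 3.10, "`Π` is temp-slim"** (p. 45 l. 11–12) for the group-level interface
`D : TemperedArithmeticGroup K`: from a special-fibre tower over `Δ` and the slimness of `G_K` ONLY —
the openness of `Π ↠ G_K` used by `SpecialFibreTower.isSlimGroup_pi` is the theorem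
`TemperedArithmeticGroup.augIsOpenMap_holds`. [cite: MochizukiSemiAnbd2006, Ex 3.10 p.45] -/
theorem SpecialFibreTower.isSlimGroup_pi_of_slim_galois {D : TemperedArithmeticGroup K}
    (T : SpecialFibreTower D.delta) (hG : IsSlimGroup (Field.absoluteGaloisGroup K)) :
    IsSlimGroup D.Pi :=
  T.isSlimGroup_pi D.augIsOpenMap_holds hG

/-- **Example 3.10, conclusion, for `K/ℚ_p` finite** (the printed setting): both `Δ` and `Π` are
(temp-)slim from a special-fibre tower ALONE — `G_K` slim is the tree theorem `galoisMLF_slim_holds`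
([AbsAnab] Thm. 1.1.1 (ii)) and the augmentation is open by `augIsOpenMap_holds`.
[cite: MochizukiSemiAnbd2006, Ex 3.10 p.45] -/
theorem SpecialFibreTower.isSlimGroup_delta_and_pi_of_tower {p : ℕ} [Fact p.Prime] {K : Type}
    [Field K] [Algebra ℚ_[p] K] [FiniteDimensional ℚ_[p] K] {D : TemperedArithmeticGroup K}
    (T : SpecialFibreTower D.delta) : IsSlimGroup D.delta ∧ IsSlimGroup D.Pi :=
  T.isSlimGroup_delta_and_pi (p := p) D.augIsOpenMap_holds

/-- What the named statement `Ex310TowerStatement Ω` buys, WITHOUT the `AugIsOpenMap` binder of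
`isSlimGroup_of_ex310TowerStatement`: under the tower-existence statement, the slimness of `G_K` and
an exhaustive sequence of open characteristic normal finite-index subgroups of `Δ`, the groups `Δ` and
`Π` of a datum carrying certified special-fibre data are slim. [cite: MochizukiSemiAnbd2006, Ex 3.10 p.45] -/
theorem isSlimGroup_of_ex310TowerStatement_of_slim_galois {Ω : SpecialFibreOrigin K}
    (h : Ex310TowerStatement Ω) {D : TemperedArithmeticGroup K} {S : SpecialFibreData D}
    (hS : Ω.IsSpecialFibreOf D S) (N : ℕ → Subgroup D.delta) (hanti : Antitone N)
    (hopen : ∀ i, IsOpen (N i : Set D.delta))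
    (hchar : ∀ (i) (φ : D.delta ≃ₜ* D.delta), (N i).map φ.toMulEquiv.toMonoidHom = N i)
    (hnormal : ∀ i, (N i).Normal) (hfi : ∀ i, (N i).FiniteIndex)
    (hexh : ∀ g, (∀ i, g ∈ N i) → g = 1) (hG : IsSlimGroup (Field.absoluteGaloisGroup K)) :
    IsSlimGroup D.delta ∧ IsSlimGroup D.Pi :=
  isSlimGroup_of_ex310TowerStatement h hS N hanti hopen hchar hnormal hfi hexh D.augIsOpenMap_holds hG

end GroupLevel

/-! ## The §6 curve-level interface `TemperedCurve p` -/

namespace TemperedCurve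

variable {p : ℕ} [Fact p.Prime]

/-- **Example 3.10, "`Π` is temp-slim"**, at the §6 interface `X : TemperedCurve p`: a special-fibre
tower over `Δ^temp_X` makes `Π^temp_{X_K}` slim as soon as `Π^temp_{X_K}` is tempered (Def. 3.1 (i))
with first-countable (e.g. Galois-countable) topology — the openness of `Π^temp_{X_K} → G_{ℚ_p}`
required by `isSlimGroup_piTemp_of_tower` being the theorem `isOpenMap_aug_of_isTempered`.  This is
the printed derivation behind the raw binder `hslimX : IsSlimGroup D.PiTemp` (GAP-LEDGER G-w4d021-3)
with the companion binder `haugOpen : IsOpenMap D.aug` ELIMINATED in favour of temperedness.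
[cite: MochizukiSemiAnbd2006, Ex 3.10 p.45] -/
theorem isSlimGroup_piTemp_of_tower_of_isTempered (X : TemperedCurve p)
    (T : SpecialFibreTower X.DeltaTemp) (hX : IsTempered X.PiTemp) [FirstCountableTopology X.PiTemp] :
    IsSlimGroup X.PiTemp :=
  X.isSlimGroup_piTemp_of_tower T (X.isOpenMap_aug_of_isTempered hX)

/-- Both halves of the conclusion of Example 3.10 at the §6 interface, from a tower and temperedness
(no openness binder). [cite: MochizukiSemiAnbd2006, Ex 3.10 p.45] -/
theorem isSlimGroup_piTemp_and_deltaTemp_of_tower_of_isTempered (X : TemperedCurve p)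
    (T : SpecialFibreTower X.DeltaTemp) (hX : IsTempered X.PiTemp) [FirstCountableTopology X.PiTemp] :
    IsSlimGroup X.PiTemp ∧ IsSlimGroup X.DeltaTemp :=
  X.isSlimGroup_piTemp_and_deltaTemp_of_tower T (X.isOpenMap_aug_of_isTempered hX)

/-- Open subgroups of `Π^temp_{X_K}` have open images in `G_{ℚ_p}` whenever `Π^temp_{X_K}` is tempered
with first-countable topology (§6 p. 69: the exact sequence is one of topological groups and
`G_K ≤ G_{ℚ_p}` is open). [cite: MochizukiSemiAnbd2006, §6 p.69] -/
theorem isOpen_map_aug_of_isTempered (X : TemperedCurve p) (hX : IsTempered X.PiTemp)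
    [FirstCountableTopology X.PiTemp] (U : Subgroup X.PiTemp) (hU : IsOpen (U : Set X.PiTemp)) :
    IsOpen ((U.map X.aug.toMonoidHom : Subgroup (GQp p)) : Set (GQp p)) :=
  X.isOpen_map_aug_of_isOpenMap (X.isOpenMap_aug_of_isTempered hX) U hU

end TemperedCurve

end Literature.AnabelianGeometry.SemiGraphs

end
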